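import Literature.MathematicalPhysics.QuantumLattice.RandomField
import Mathlib.MeasureTheory.Integral.Bochner.Basic
import HarnessLib

/-!
# Ball-indexed (local) specifications for laws of random distributions (Röckner-style)

A specification in the sense of Preston / Föllmer / Georgii, indexed not by finite subsets of a
lattice (the tree's `Literature.Probability.LatticeModels.Specification` / `IsSpecification`,
Georgii 2011 Def. 1.23) but by closed Euclidean BALLS, for laws of random (tempered) distributions
`ω ∈ Ω = FieldConfig E = 𝓢'(E)` (`Literature/MathematicalPhysics/QuantumLattice/RandomField`):
M. Röckner, *Specifications and Martin boundaries for `P(φ)₂`-random fields*, Comm. Math. Phys. 106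
(1986) 105–135 (local specifications `(π_U)` for Euclidean fields indexed by open sets, built on
Guerra–Rosen–Simon's Markov property, Ann. Math. 101 (1975)); the lattice analogue is Georgii's
Def. 1.23 ((i) probability kernels, (ii) exterior measurability, (iii) properness,
(iv) consistency). Requested (with this exact clause list) by the route
`CriticalPhenomena/Ising3DConformalLimit/BallSpecification`, items 5728/5729, which inline
clauses (i)–(iv) and the DLR equations.

## Contents (definitions + elementary API; no named facts)

* `extEvents U` — the σ-algebra of events seen by the test functions supported in `U ⊆ E`
  (`⨆_{tsupport f ⊆ U} comap (ω ↦ ω f) borel`); `germEvents c r` — the exterior GERM σ-algebra at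
  the sphere `∂B(c, r)` (`⨅_{ε > 0} extEvents (ball c (r+ε) ∖ closedBall c r)`);
  `shellTopology c r ε` — the topology on `Ω` of pointwise convergence on test functions supported
  in the shell `ball c (r + ε) ∖ closedBall c r`;
* `IsBallSpecification γ` for kernels `γ : E → ℝ → Ω → Measure Ω` (centre, radius `r > 0`,
  exterior datum): (i) probability, (ii) exterior measurability, (iii) MARKOV across spheres
  (interior events depend on the exterior datum only through its germ at the sphere),
  (iv) properness, (v) consistency — the INHABITED CORE that the route items inline;
* `IsShellFeller γ good τ` — Feller / quasilocal regularity of the kernels in the exterior datum,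
  as a SEPARATE predicate, relative to a set `good` of regular exterior data and a topology `τ` on
  `Ω` chosen by the consumer (review of p43615: the weak-* / `shellTopology` form on ALL of `𝓢'`
  is unsatisfiable for every non-degenerate Markov Euclidean field — the conditional laws depend
  on the exterior datum through its TRACE on the sphere, which is not weak-*-continuous in finitely
  many evaluations — so the version-pinning clause must live on regular data with a strong
  topology, e.g. `C^k`-convergence of shell-smooth data; Röckner 1986 §1 defines the kernels on
  "nice" configurations only);
* `IsGibbsFor γ ν U` — the DLR equations on the balls with closure inside the open set `U`
  (`U = univ`: DLR; `U = {0}ᶜ`: the punctured condition), `IsBallSpecified μ`;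
* proved: `extEvents_mono`, `measurable_eval_of_tsupport_subset`, `germEvents_le_extEvents_compl`
  (the germ is exterior), `extEvents_le` (all these σ-algebras are sub-σ-algebras of the Borel
  one), `IsGibbsFor.mono` (restriction `U' ⊆ U`), `IsGibbsFor.isProbabilityMeasure`,
  `IsShellFeller.mono` (shrinking the good set).

All kernel clauses are guarded by `0 < r` (for `r ≤ 0` the closed ball is empty or a point and
properness would force `γ c r η = δ_η`, an irrelevant obligation).

Not here (bridge left as a follow-up, theorem-level): `IsGibbsFor γ μ univ ⇒ (η ↦ γ c r η A)` is a
version of `μ[A | extEvents (closedBall c r)ᶜ]` (the `isGibbsMeasure_iff_condExp` analogue).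

## References

* [Rockner1986] M. Röckner, Comm. Math. Phys. 106 (1986) 105–135, §§1–2 (local specifications for
  Euclidean fields). doi:10.1007/BF01210928.
* [GuerraRosenSimon1975] F. Guerra, L. Rosen, B. Simon, Ann. of Math. 101 (1975) (Markov property).
* [Georgii2011] H.-O. Georgii, *Gibbs Measures and Phase Transitions*, 2nd ed. (2011), Def. 1.23.
-/

noncomputable section

open MeasureTheory Metric Set TopologicalSpace
open scoped SchwartzMap ENNReal

namespace Literature.MathematicalPhysics.QuantumLattice

variable {E : Type*} [NormedAddCommGroup E] [NormedSpace ℝ E]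

/-! ### Local σ-algebras of events -/

/-- **Events seen in `U`**: the σ-algebra on `Ω = FieldConfig E` generated by the evaluations
`ω ↦ ω f` at the test functions `f` with `tsupport f ⊆ U` (Röckner's `σ(φ(f) : supp f ⊂ U)`). [cite: Rockner1986, §1] -/
@[reducible] def extEvents (U : Set E) : MeasurableSpace (FieldConfig E) :=
  ⨆ (f : 𝓢(E, ℝ)) (_ : tsupport f ⊆ U), MeasurableSpace.comap (fun ω : FieldConfig E => ω f) (borel ℝ)

/-- `extEvents` is monotone in the region. [folklore] -/
theorem extEvents_mono {U V : Set E} (h : U ⊆ V) : extEvents (E := E) U ≤ extEvents V :=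
  iSup₂_le fun f hf => le_iSup₂_of_le f (hf.trans h) le_rfl

/-- Every `extEvents U` is a sub-σ-algebra of the Borel σ-algebra of `Ω` (evaluations are
continuous for the weak-* topology). [folklore] -/
theorem extEvents_le (U : Set E) :
    extEvents (E := E) U ≤ (FieldConfig.instMeasurableSpace : MeasurableSpace (FieldConfig E)) :=
  iSup₂_le fun f _ => (measurable_eval f).comap_le

/-- An evaluation at a test function supported in `U` is `extEvents U`-measurable. [folklore] -/
theorem measurable_eval_of_tsupport_subset {U : Set E} {f : 𝓢(E, ℝ)} (hf : tsupport f ⊆ U) :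
    Measurable[extEvents U] fun ω : FieldConfig E => ω f := by
  refine Measurable.of_comap_le ?_
  borelize ℝ
  exact le_iSup₂_of_le (f := fun (f : 𝓢(E, ℝ)) (_ : tsupport f ⊆ U) =>
    MeasurableSpace.comap (fun ω : FieldConfig E => ω f) (borel ℝ)) f hf le_rfl

/-- **The exterior germ σ-algebra at the sphere `∂B(c, r)`**: events seen in every shell
`B(c, r + ε) ∖ B̄(c, r)`, `ε > 0`. [cite: Rockner1986, §1] -/
@[reducible] def germEvents (c : E) (r : ℝ) : MeasurableSpace (FieldConfig E) :=
  ⨅ (ε : ℝ) (_ : 0 < ε), extEvents (ball c (r + ε) \ closedBall c r)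

/-- The germ at the sphere is an exterior σ-algebra: `germEvents c r ≤ extEvents (closedBall c r)ᶜ`. [folklore] -/
theorem germEvents_le_extEvents_compl (c : E) (r : ℝ) :
    germEvents (E := E) c r ≤ extEvents (closedBall c r)ᶜ :=
  (iInf₂_le (1 : ℝ) one_pos).trans (extEvents_mono (sdiff_subset_compl _ _))

/-- **The shell topology**: pointwise convergence of configurations on the test functions supported
in the shell `B(c, r + ε) ∖ B̄(c, r)` (coarser than the weak-* topology of `Ω`). [folklore] -/
@[reducible] def shellTopology (c : E) (r ε : ℝ) : TopologicalSpace (FieldConfig E) :=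
  ⨅ (f : 𝓢(E, ℝ)) (_ : tsupport f ⊆ ball c (r + ε) \ closedBall c r),
    TopologicalSpace.induced (fun ω : FieldConfig E => ω f) inferInstance

/-! ### Ball specifications -/

/-- **Ball specification** (Röckner-style local specification for Euclidean random fields, the
ball-indexed analogue of Georgii's Def. 1.23 as requested by the route `BallSpecification`):
kernels `γ c r η` (`r > 0`) = "the law inside the closed ball `B̄(c, r)` given the exterior datum
`η`", with (i) `γ c r η` a probability measure; (ii) `η ↦ γ c r η A` measurable w.r.t. the exterior
events `extEvents (closedBall c r)ᶜ`; (iii) MARKOV PROPERTY across spheres: for interior events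
`A` (`extEvents (ball c r)`-measurable) `η ↦ γ c r η A` is even `germEvents c r`-measurable;
(iv) PROPER: `γ c r η`-a.e. configuration agrees with `η` on test functions supported outside
`B̄(c, r)`; (v) CONSISTENT: `γ_{c',r'} γ_{c,r} = γ_{c',r'}` whenever `B̄(c, r) ⊆ B(c', r')`. The
Feller / version-pinning regularity is the separate predicate `IsShellFeller`. [cite: Rockner1986, §1] -/
structure IsBallSpecification (γ : E → ℝ → FieldConfig E → Measure (FieldConfig E)) : Prop where
  /-- (i) Each kernel value is a probability measure. -/
  isProbability : ∀ c r, 0 < r → ∀ η, IsProbabilityMeasure (γ c r η)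
  /-- (ii) Exterior measurability of `η ↦ γ c r η A`. -/
  measurable : ∀ c r, 0 < r → ∀ (A : Set (FieldConfig E)), MeasurableSet A →
    Measurable[extEvents (closedBall c r)ᶜ] fun η => γ c r η A
  /-- (iii) Markov property: interior events depend on the exterior datum only through its germ. -/
  markov : ∀ c r, 0 < r → ∀ (A : Set (FieldConfig E)), MeasurableSet[extEvents (ball c r)] A →
    Measurable[germEvents c r] fun η => γ c r η A
  /-- (iv) Properness: outside the ball the kernel reproduces the datum. -/
  proper : ∀ c r, 0 < r → ∀ η, ∀ᵐ ω ∂(γ c r η),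
    ∀ f : 𝓢(E, ℝ), tsupport f ⊆ (closedBall c r)ᶜ → ω f = η f
  /-- (v) Consistency of nested balls. -/
  consistent : ∀ c r, 0 < r → ∀ c' r', closedBall c r ⊆ ball c' r' → ∀ η (A : Set (FieldConfig E)),
    MeasurableSet A → ∫⁻ ω, γ c r ω A ∂(γ c' r' η) = γ c' r' η A

/-- **Feller / quasilocal regularity of ball kernels in the exterior datum** (van Enter–Fernández–
Sokal Def. 2.9/2.14 transposed; it pins down the VERSION of the kernels), RELATIVE TO a set `good`
of regular exterior data and a topology `τ` on `Ω` chosen by the consumer: for `r > 0`, test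
functions `f₁, …, f_m` supported in `B(c, r)` and bounded continuous `F`, the map
`η ↦ ∫ F(ω f₁, …, ω f_m) dγ c r η` is `τ`-continuous on `good`. WARNING (review of the first
version): with `good = univ` and `τ` the weak-* topology (or any `shellTopology`) this is FALSE for
every non-degenerate Markov Euclidean field (GFF, critical fields): the conditional laws depend on
the datum through its trace on the sphere, which is not continuous in finitely many evaluations. Use
regular (e.g. shell-smooth) data with a strong (`C^k` / Sobolev on the shell) topology. [folklore] -/
def IsShellFeller (γ : E → ℝ → FieldConfig E → Measure (FieldConfig E)) (good : Set (FieldConfig E))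
    (τ : TopologicalSpace (FieldConfig E)) : Prop :=
  ∀ c r, 0 < r → ∀ (m : ℕ) (f : Fin m → 𝓢(E, ℝ)), (∀ i, tsupport (f i) ⊆ ball c r) →
    ∀ (F : (Fin m → ℝ) → ℝ), Continuous F → (∃ C, ∀ v, |F v| ≤ C) →
      @ContinuousOn _ _ τ inferInstance (fun η => ∫ ω, F (fun i => ω (f i)) ∂(γ c r η)) good

/-- Feller regularity on a good set is inherited by smaller good sets. [folklore] -/
theorem IsShellFeller.mono {γ : E → ℝ → FieldConfig E → Measure (FieldConfig E)}
    {good good' : Set (FieldConfig E)} {τ : TopologicalSpace (FieldConfig E)}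
    (h : IsShellFeller γ good τ) (hsub : good' ⊆ good) : IsShellFeller γ good' τ :=
  fun c r hr m f hf F hF hB => (h c r hr m f hf F hF hB).mono hsub

/-- **DLR equations on the balls inside `U`** (`U = univ`: the usual Dobrushin–Lanford–Ruelle
condition; `U = {0}ᶜ`: the PUNCTURED condition of the route): `ν` is a probability measure and
`ν (A ∩ B) = ∫_B γ c r η A dν` for every closed ball `B̄(c, r) ⊆ U` (`r > 0`), every event `A` and
every exterior event `B ∈ extEvents (closedBall c r)ᶜ`. [cite: Rockner1986, §1] [cite: Georgii2011, Def. 1.23] -/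
def IsGibbsFor (γ : E → ℝ → FieldConfig E → Measure (FieldConfig E)) (ν : Measure (FieldConfig E))
    (U : Set E) : Prop :=
  IsProbabilityMeasure ν ∧
    ∀ c r, 0 < r → closedBall c r ⊆ U → ∀ (A : Set (FieldConfig E)), MeasurableSet A →
      ∀ (B : Set (FieldConfig E)), MeasurableSet[extEvents (closedBall c r)ᶜ] B →
        ν (A ∩ B) = ∫⁻ η in B, γ c r η A ∂ν

/-- **`μ` is specified by some ball specification** (it is a Gibbs measure for a Röckner-style
local specification, DLR on all balls). [cite: Rockner1986, §1] -/
def IsBallSpecified (μ : Measure (FieldConfig E)) : Prop :=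
  ∃ γ, IsBallSpecification γ ∧ IsGibbsFor γ μ univ

namespace IsGibbsFor

variable {γ : E → ℝ → FieldConfig E → Measure (FieldConfig E)} {ν : Measure (FieldConfig E)}
  {U U' : Set E}

/-- A law satisfying DLR on the balls inside `U` is a probability measure. [folklore] -/
theorem isProbabilityMeasure (h : IsGibbsFor γ ν U) : IsProbabilityMeasure ν := h.1

/-- **Restriction**: DLR on the balls inside `U` implies DLR on the balls inside any `U' ⊆ U`
(in particular `univ ⇒ {0}ᶜ`). [folklore] -/
theorem mono (h : IsGibbsFor γ ν U) (hU : U' ⊆ U) : IsGibbsFor γ ν U' :=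
  ⟨h.1, fun c r hr hsub A hA B hB => h.2 c r hr (hsub.trans hU) A hA B hB⟩

/-- The DLR equation with `B = univ`: `ν A = ∫ γ c r η A dν` for balls inside `U`. [folklore] -/
theorem measure_eq_lintegral (h : IsGibbsFor γ ν U) {c : E} {r : ℝ} (hr : 0 < r)
    (hsub : closedBall c r ⊆ U) {A : Set (FieldConfig E)} (hA : MeasurableSet A) :
    ν A = ∫⁻ η, γ c r η A ∂ν := by
  have := h.2 c r hr hsub A hA univ MeasurableSet.univ
  rwa [inter_univ, Measure.restrict_univ] at this

end IsGibbsFor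

/-- A ball-specified law is a probability measure. [folklore] -/
theorem IsBallSpecified.isProbabilityMeasure {μ : Measure (FieldConfig E)} (h : IsBallSpecified μ) :
    IsProbabilityMeasure μ := by
  obtain ⟨γ, -, hG⟩ := h
  exact hG.isProbabilityMeasure

end Literature.MathematicalPhysics.QuantumLattice

end
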